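import Summits.Ventures.Crystal3D.Theorems.StickyWulffConstantCoaxialWallLawSingleVacancy
import HarnessLib

/-!
# Two adjacent vacancies in the fcc kissing shell: the lens lemma (base pair and 12 representatives)

HONEST FRAMING. Part of the venture `Summits/Ventures/Crystal3D` (cell `crystal3d-full`), helper
`--supports` the crux `CoaxialWallLaw` (stmt-Ventures-19481, `route-Ventures-StickyWulffConstant`),
REGISTERED line `WallLedgerF` (planner cf-p1 gen 16), stub `stub_coaxialTwoSlabAdhesion`
(terrace/riser slot ledger); usable by `WallLedgerG` (stmt-Ventures-19480) as well.  Continues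
`…CoaxialWallLawSingleVacancy` (`k = 1`: one vacancy hosts no foreign contact).  Pure algebra in the
cubic frame of `D₃` (`2‖p‖² = A² + B² + C²`; slots = the twelve `(±1,±1,0)`-type triples, foreign
contact directions = real triples of norm² `2`, «does not overlap the ball in slot `s`» =
«inner product with `s` at most `1`»).

THE LENS LEMMA.  Two ADJACENT vacant slots `v, v'` (`⟨v,v'⟩ = 1`): the directions compatible with
the ten other slots form a lens between `v` and `v'`; two compatible directions at mutual inner
product `≤ 1` (two non-overlapping foreign balls) are exactly `{v, v'}` — so a lattice ball with
two adjacent vacancies has at most ONE foreign contact: the `k = 2` case of the absorption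
inequality `mix ≤ vac_V + ½ vac_U` of the riser ledger (this seat's evidence RISER-LEDGER-FINDINGS.md
on stmt-Ventures-19481).
Base pair `(1,1,0), (1,0,1)` (`cubicShell_lens_base`): the four slots `(0,±1,±1)` give
`y² + z² ≤ 1`, so `x² ≥ 1`; the slots with first coordinate `−1` exclude `x ≤ −1`; hence
`x, x' ≥ 1`, `y, z, y', z' ≥ 0`, and `1 ≥ xx' + yy' + zz' ≥ xx' ≥ 1` forces `x = x' = 1`,
`yy' = zz' = 0`, i.e. `{(x,y,z),(x',y',z')} = {(1,1,0),(1,0,1)}`.  Twelve representatives of the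
24 list-ordered adjacent pairs modulo the antipodal map follow by signed coordinate permutations
(`cubicShell_lens_repr₁/₂`, six mechanical cases each); the antipodal transfer and the wrappers are
in `…CoaxialWallLawDoubleVacancy`.
WHAT THIS IS NOT: three or more vacancies (ribbon / face-hole lemmas); the stub; rung F-C1 not moved.
-/

noncomputable section

namespace Summit.Ventures.Crystal3D.Theorems

/-- The lens of the base pair: the ten slot constraints off `(1,1,0), (1,0,1)` force `p ≥ 1` and
`q, r ≥ 0` (cubic coordinates). -/
theorem cubicShell_lens_aux (p q r : ℝ) (hp : p ^ 2 + q ^ 2 + r ^ 2 = 2) (a1 : -p + q ≤ 1)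
    (a2 : -p - q ≤ 1) (a3 : -p + r ≤ 1) (a4 : -p - r ≤ 1) (b1 : q + r ≤ 1) (b2 : q - r ≤ 1)
    (b3 : -q + r ≤ 1) (b4 : -q - r ≤ 1) (c1 : p - q ≤ 1) (c2 : p - r ≤ 1) :
    1 ≤ p ∧ 0 ≤ q ∧ 0 ≤ r := by
  have t1 : 0 ≤ (1 - (q + r)) * (1 + (q + r)) := mul_nonneg (by linarith) (by linarith)
  have t2 : 0 ≤ (1 - (q - r)) * (1 + (q - r)) := mul_nonneg (by linarith) (by linarith)
  have hqr : q ^ 2 + r ^ 2 ≤ 1 := by nlinarith [t1, t2]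
  have hp2 : 1 ≤ p ^ 2 := by linarith
  have hp1 : 1 ≤ p := by
    by_contra hlt
    push Not at hlt
    have hneg : p + 1 ≤ 0 := by
      by_contra hpos
      push Not at hpos
      have := mul_neg_of_neg_of_pos (show p - 1 < 0 by linarith) hpos
      nlinarith [this]
    have hq0 : q = 0 := by apply le_antisymm <;> linarith
    have hr0 : r = 0 := by apply le_antisymm <;> linarith
    subst hq0; subst hr0
    have : p = -1 := by apply le_antisymm <;> linarith
    subst this
    norm_num at hp
  exact ⟨hp1, by linarith, by linarith⟩

/-- The two ends of the lens: with `p = 1`, `q, r ≥ 0`, `q + r ≤ 1` and `1 + q² + r² = 2`, the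
point is `(1,1,0)` or `(1,0,1)`. -/
theorem cubicShell_lens_ends_aux (q r : ℝ) (hqr : 1 ^ 2 + q ^ 2 + r ^ 2 = 2) (hq : 0 ≤ q)
    (hr : 0 ≤ r) (hs : q + r ≤ 1) : (q = 1 ∧ r = 0) ∨ (q = 0 ∧ r = 1) := by
  have hs2 : (q + r) ^ 2 ≤ 1 := by
    have := mul_le_mul hs hs (by linarith) zero_le_one
    nlinarith [this]
  have hprod : q * r = 0 := by nlinarith [hs2, mul_nonneg hq hr]
  rcases mul_eq_zero.1 hprod with hq0 | hr0
  · right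
    subst hq0
    have hr2 : r ^ 2 = 1 := by linarith
    exact ⟨rfl, (pow_eq_one_iff_of_nonneg hr two_ne_zero).1 hr2⟩
  · left
    subst hr0
    have hq2 : q ^ 2 = 1 := by linarith
    exact ⟨(pow_eq_one_iff_of_nonneg hq two_ne_zero).1 hq2, rfl⟩

/-- **Lens lemma, base pair `v = (1,1,0)`, `v' = (1,0,1)`.**  Two norm²-`2` triples, each with inner
product `≤ 1` against the ten slots other than `v, v'`, and with mutual inner product `≤ 1`, are
`v` and `v'` in some order. -/
theorem cubicShell_lens_base (x y z x' y' z' : ℝ) (hn : x ^ 2 + y ^ 2 + z ^ 2 = 2)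
    (hn' : x' ^ 2 + y' ^ 2 + z' ^ 2 = 2)
    (h1 : x - y ≤ 1)
    (h2 : - x + y ≤ 1)
    (h3 : - x - y ≤ 1)
    (h4 : x - z ≤ 1)
    (h5 : - x + z ≤ 1)
    (h6 : - x - z ≤ 1)
    (h7 : y + z ≤ 1)
    (h8 : y - z ≤ 1)
    (h9 : - y + z ≤ 1)
    (h10 : - y - z ≤ 1)
    (k1 : x' - y' ≤ 1)
    (k2 : - x' + y' ≤ 1)
    (k3 : - x' - y' ≤ 1)
    (k4 : x' - z' ≤ 1)
    (k5 : - x' + z' ≤ 1)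
    (k6 : - x' - z' ≤ 1)
    (k7 : y' + z' ≤ 1)
    (k8 : y' - z' ≤ 1)
    (k9 : - y' + z' ≤ 1)
    (k10 : - y' - z' ≤ 1)
    (hin : x * x' + y * y' + z * z' ≤ 1) :
    (x = 1 ∧ y = 1 ∧ z = 0 ∧ x' = 1 ∧ y' = 0 ∧ z' = 1) ∨
      (x = 1 ∧ y = 0 ∧ z = 1 ∧ x' = 1 ∧ y' = 1 ∧ z' = 0) := by
  obtain ⟨hx, hy, hz⟩ := cubicShell_lens_aux x y z hn h2 h3 h5 h6 h7 h8 h9 h10 h1 h4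
  obtain ⟨hx', hy', hz'⟩ := cubicShell_lens_aux x' y' z' hn' k2 k3 k5 k6 k7 k8 k9 k10 k1 k4
  -- `1 ≥ xx' + yy' + zz' ≥ xx' ≥ 1`
  have hxx : 1 ≤ x * x' := by
    have := mul_le_mul hx hx' zero_le_one (by linarith)
    linarith
  have hyy : 0 ≤ y * y' := mul_nonneg hy hy'
  have hzz : 0 ≤ z * z' := mul_nonneg hz hz'
  have hxx1 : x * x' = 1 := by linarith
  have hxle : x ≤ x * x' := by
    have := mul_le_mul_of_nonneg_left hx' (show (0 : ℝ) ≤ x by linarith)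
    linarith
  have hxle' : x' ≤ x * x' := by
    have := mul_le_mul_of_nonneg_right hx (show (0 : ℝ) ≤ x' by linarith)
    linarith
  have hx1 : x = 1 := le_antisymm (by linarith) hx
  have hx1' : x' = 1 := le_antisymm (by linarith) hx'
  have hyy0 : y * y' = 0 := by linarith
  have hzz0 : z * z' = 0 := by linarith
  subst hx1; subst hx1'
  rcases cubicShell_lens_ends_aux y z hn hy hz h7 with ⟨rfl, rfl⟩ | ⟨rfl, rfl⟩ <;>
    rcases cubicShell_lens_ends_aux y' z' hn' hy' hz' k7 with ⟨rfl, rfl⟩ | ⟨rfl, rfl⟩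
  · norm_num at hyy0
  · left; exact ⟨rfl, rfl, rfl, rfl, rfl, rfl⟩
  · right; exact ⟨rfl, rfl, rfl, rfl, rfl, rfl⟩
  · norm_num at hzz0

/-- **Lens lemma, representatives 1–6** (signed coordinate permutations of the base pair). -/
theorem cubicShell_lens_repr₁ (a b c a' b' c' : ℝ) (hn : a ^ 2 + b ^ 2 + c ^ 2 = 2)
    (hn' : a' ^ 2 + b' ^ 2 + c' ^ 2 = 2) (v v' : ℤ × ℤ × ℤ)
    (hvv' : (v, v') ∈ ([(((1 : ℤ), (1 : ℤ), (0 : ℤ)), ((1 : ℤ), (0 : ℤ), (1 : ℤ))),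
        ((1, 1, 0), (1, 0, -1)),
        ((1, 1, 0), (0, 1, 1)),
        ((1, 1, 0), (0, 1, -1)),
        ((1, -1, 0), (1, 0, 1)),
        ((1, -1, 0), (1, 0, -1))] : List ((ℤ × ℤ × ℤ) × (ℤ × ℤ × ℤ))))
    (h : ∀ s ∈ ([((1 : ℤ), (1 : ℤ), (0 : ℤ)), (1, -1, 0), (-1, 1, 0), (-1, -1, 0), (1, 0, 1), (1, 0, -1),
        (-1, 0, 1), (-1, 0, -1), (0, 1, 1), (0, 1, -1), (0, -1, 1), (0, -1, -1)] : List (ℤ × ℤ × ℤ)), s ≠ v → s ≠ v' →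
      a * (s.1 : ℝ) + b * (s.2.1 : ℝ) + c * (s.2.2 : ℝ) ≤ 1)
    (h' : ∀ s ∈ ([((1 : ℤ), (1 : ℤ), (0 : ℤ)), (1, -1, 0), (-1, 1, 0), (-1, -1, 0), (1, 0, 1), (1, 0, -1),
        (-1, 0, 1), (-1, 0, -1), (0, 1, 1), (0, 1, -1), (0, -1, 1), (0, -1, -1)] : List (ℤ × ℤ × ℤ)), s ≠ v → s ≠ v' →
      a' * (s.1 : ℝ) + b' * (s.2.1 : ℝ) + c' * (s.2.2 : ℝ) ≤ 1)
    (hin : a * a' + b * b' + c * c' ≤ 1) :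
    (a = v.1 ∧ b = v.2.1 ∧ c = v.2.2 ∧ a' = v'.1 ∧ b' = v'.2.1 ∧ c' = v'.2.2) ∨
      (a = v'.1 ∧ b = v'.2.1 ∧ c = v'.2.2 ∧ a' = v.1 ∧ b' = v.2.1 ∧ c' = v.2.2) := by
  simp only [List.mem_cons, List.mem_nil_iff, or_false, Prod.mk.injEq] at hvv'
  rcases hvv' with ⟨rfl, rfl⟩ | ⟨rfl, rfl⟩ | ⟨rfl, rfl⟩ | ⟨rfl, rfl⟩ | ⟨rfl, rfl⟩ | ⟨rfl, rfl⟩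
  · -- (v, v') = ((1, 1, 0), (1, 0, 1))
    simp only [List.forall_mem_cons, ne_eq, Prod.mk.injEq] at h h'
    norm_num at h h'
    obtain ⟨g1, g2, g3, g4, g5, g6, g7, g8, g9, g10⟩ := h
    obtain ⟨k1, k2, k3, k4, k5, k6, k7, k8, k9, k10⟩ := h'
    have hsq : (a) ^ 2 + (b) ^ 2 + (c) ^ 2 = 2 := by linear_combination hn
    have hsq' : (a') ^ 2 + (b') ^ 2 + (c') ^ 2 = 2 := by linear_combination hn'
    have hin' : (a) * (a') + (b) * (b') + (c) * (c') ≤ 1 := by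
      have e : (a) * (a') + (b) * (b') + (c) * (c') = a * a' + b * b' + c * c' := by ring
      rw [e]; exact hin
    rcases cubicShell_lens_base (a) (b) (c) (a') (b') (c') hsq hsq'
      (by linarith) (by linarith) (by linarith) (by linarith) (by linarith)
      (by linarith) (by linarith) (by linarith) (by linarith) (by linarith)
      (by linarith) (by linarith) (by linarith) (by linarith) (by linarith)
      (by linarith) (by linarith) (by linarith) (by linarith) (by linarith) hin' with
      ⟨e1, e2, e3, e4, e5, e6⟩ | ⟨e1, e2, e3, e4, e5, e6⟩
    · left; refine ⟨?_, ?_, ?_, ?_, ?_, ?_⟩ <;> push_cast <;> linarith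
    · right; refine ⟨?_, ?_, ?_, ?_, ?_, ?_⟩ <;> push_cast <;> linarith
  · -- (v, v') = ((1, 1, 0), (1, 0, -1))
    simp only [List.forall_mem_cons, ne_eq, Prod.mk.injEq] at h h'
    norm_num at h h'
    obtain ⟨g1, g2, g3, g4, g5, g6, g7, g8, g9, g10⟩ := h
    obtain ⟨k1, k2, k3, k4, k5, k6, k7, k8, k9, k10⟩ := h'
    have hsq : (a) ^ 2 + (b) ^ 2 + (-c) ^ 2 = 2 := by linear_combination hn
    have hsq' : (a') ^ 2 + (b') ^ 2 + (-c') ^ 2 = 2 := by linear_combination hn'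
    have hin' : (a) * (a') + (b) * (b') + (-c) * (-c') ≤ 1 := by
      have e : (a) * (a') + (b) * (b') + (-c) * (-c') = a * a' + b * b' + c * c' := by ring
      rw [e]; exact hin
    rcases cubicShell_lens_base (a) (b) (-c) (a') (b') (-c') hsq hsq'
      (by linarith) (by linarith) (by linarith) (by linarith) (by linarith)
      (by linarith) (by linarith) (by linarith) (by linarith) (by linarith)
      (by linarith) (by linarith) (by linarith) (by linarith) (by linarith)
      (by linarith) (by linarith) (by linarith) (by linarith) (by linarith) hin' with
      ⟨e1, e2, e3, e4, e5, e6⟩ | ⟨e1, e2, e3, e4, e5, e6⟩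
    · left; refine ⟨?_, ?_, ?_, ?_, ?_, ?_⟩ <;> push_cast <;> linarith
    · right; refine ⟨?_, ?_, ?_, ?_, ?_, ?_⟩ <;> push_cast <;> linarith
  · -- (v, v') = ((1, 1, 0), (0, 1, 1))
    simp only [List.forall_mem_cons, ne_eq, Prod.mk.injEq] at h h'
    norm_num at h h'
    obtain ⟨g1, g2, g3, g4, g5, g6, g7, g8, g9, g10⟩ := h
    obtain ⟨k1, k2, k3, k4, k5, k6, k7, k8, k9, k10⟩ := h'
    have hsq : (b) ^ 2 + (a) ^ 2 + (c) ^ 2 = 2 := by linear_combination hn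
    have hsq' : (b') ^ 2 + (a') ^ 2 + (c') ^ 2 = 2 := by linear_combination hn'
    have hin' : (b) * (b') + (a) * (a') + (c) * (c') ≤ 1 := by
      have e : (b) * (b') + (a) * (a') + (c) * (c') = a * a' + b * b' + c * c' := by ring
      rw [e]; exact hin
    rcases cubicShell_lens_base (b) (a) (c) (b') (a') (c') hsq hsq'
      (by linarith) (by linarith) (by linarith) (by linarith) (by linarith)
      (by linarith) (by linarith) (by linarith) (by linarith) (by linarith)
      (by linarith) (by linarith) (by linarith) (by linarith) (by linarith)
      (by linarith) (by linarith) (by linarith) (by linarith) (by linarith) hin' with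
      ⟨e1, e2, e3, e4, e5, e6⟩ | ⟨e1, e2, e3, e4, e5, e6⟩
    · left; refine ⟨?_, ?_, ?_, ?_, ?_, ?_⟩ <;> push_cast <;> linarith
    · right; refine ⟨?_, ?_, ?_, ?_, ?_, ?_⟩ <;> push_cast <;> linarith
  · -- (v, v') = ((1, 1, 0), (0, 1, -1))
    simp only [List.forall_mem_cons, ne_eq, Prod.mk.injEq] at h h'
    norm_num at h h'
    obtain ⟨g1, g2, g3, g4, g5, g6, g7, g8, g9, g10⟩ := h
    obtain ⟨k1, k2, k3, k4, k5, k6, k7, k8, k9, k10⟩ := h'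
    have hsq : (b) ^ 2 + (a) ^ 2 + (-c) ^ 2 = 2 := by linear_combination hn
    have hsq' : (b') ^ 2 + (a') ^ 2 + (-c') ^ 2 = 2 := by linear_combination hn'
    have hin' : (b) * (b') + (a) * (a') + (-c) * (-c') ≤ 1 := by
      have e : (b) * (b') + (a) * (a') + (-c) * (-c') = a * a' + b * b' + c * c' := by ring
      rw [e]; exact hin
    rcases cubicShell_lens_base (b) (a) (-c) (b') (a') (-c') hsq hsq'
      (by linarith) (by linarith) (by linarith) (by linarith) (by linarith)
      (by linarith) (by linarith) (by linarith) (by linarith) (by linarith)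
      (by linarith) (by linarith) (by linarith) (by linarith) (by linarith)
      (by linarith) (by linarith) (by linarith) (by linarith) (by linarith) hin' with
      ⟨e1, e2, e3, e4, e5, e6⟩ | ⟨e1, e2, e3, e4, e5, e6⟩
    · left; refine ⟨?_, ?_, ?_, ?_, ?_, ?_⟩ <;> push_cast <;> linarith
    · right; refine ⟨?_, ?_, ?_, ?_, ?_, ?_⟩ <;> push_cast <;> linarith
  · -- (v, v') = ((1, -1, 0), (1, 0, 1))
    simp only [List.forall_mem_cons, ne_eq, Prod.mk.injEq] at h h'
    norm_num at h h'
    obtain ⟨g1, g2, g3, g4, g5, g6, g7, g8, g9, g10⟩ := h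
    obtain ⟨k1, k2, k3, k4, k5, k6, k7, k8, k9, k10⟩ := h'
    have hsq : (a) ^ 2 + (-b) ^ 2 + (c) ^ 2 = 2 := by linear_combination hn
    have hsq' : (a') ^ 2 + (-b') ^ 2 + (c') ^ 2 = 2 := by linear_combination hn'
    have hin' : (a) * (a') + (-b) * (-b') + (c) * (c') ≤ 1 := by
      have e : (a) * (a') + (-b) * (-b') + (c) * (c') = a * a' + b * b' + c * c' := by ring
      rw [e]; exact hin
    rcases cubicShell_lens_base (a) (-b) (c) (a') (-b') (c') hsq hsq'
      (by linarith) (by linarith) (by linarith) (by linarith) (by linarith)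
      (by linarith) (by linarith) (by linarith) (by linarith) (by linarith)
      (by linarith) (by linarith) (by linarith) (by linarith) (by linarith)
      (by linarith) (by linarith) (by linarith) (by linarith) (by linarith) hin' with
      ⟨e1, e2, e3, e4, e5, e6⟩ | ⟨e1, e2, e3, e4, e5, e6⟩
    · left; refine ⟨?_, ?_, ?_, ?_, ?_, ?_⟩ <;> push_cast <;> linarith
    · right; refine ⟨?_, ?_, ?_, ?_, ?_, ?_⟩ <;> push_cast <;> linarith
  · -- (v, v') = ((1, -1, 0), (1, 0, -1))
    simp only [List.forall_mem_cons, ne_eq, Prod.mk.injEq] at h h'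
    norm_num at h h'
    obtain ⟨g1, g2, g3, g4, g5, g6, g7, g8, g9, g10⟩ := h
    obtain ⟨k1, k2, k3, k4, k5, k6, k7, k8, k9, k10⟩ := h'
    have hsq : (a) ^ 2 + (-b) ^ 2 + (-c) ^ 2 = 2 := by linear_combination hn
    have hsq' : (a') ^ 2 + (-b') ^ 2 + (-c') ^ 2 = 2 := by linear_combination hn'
    have hin' : (a) * (a') + (-b) * (-b') + (-c) * (-c') ≤ 1 := by
      have e : (a) * (a') + (-b) * (-b') + (-c) * (-c') = a * a' + b * b' + c * c' := by ring
      rw [e]; exact hin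
    rcases cubicShell_lens_base (a) (-b) (-c) (a') (-b') (-c') hsq hsq'
      (by linarith) (by linarith) (by linarith) (by linarith) (by linarith)
      (by linarith) (by linarith) (by linarith) (by linarith) (by linarith)
      (by linarith) (by linarith) (by linarith) (by linarith) (by linarith)
      (by linarith) (by linarith) (by linarith) (by linarith) (by linarith) hin' with
      ⟨e1, e2, e3, e4, e5, e6⟩ | ⟨e1, e2, e3, e4, e5, e6⟩
    · left; refine ⟨?_, ?_, ?_, ?_, ?_, ?_⟩ <;> push_cast <;> linarith
    · right; refine ⟨?_, ?_, ?_, ?_, ?_, ?_⟩ <;> push_cast <;> linarith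

/-- **Lens lemma, representatives 7–12** (signed coordinate permutations of the base pair). -/
theorem cubicShell_lens_repr₂ (a b c a' b' c' : ℝ) (hn : a ^ 2 + b ^ 2 + c ^ 2 = 2)
    (hn' : a' ^ 2 + b' ^ 2 + c' ^ 2 = 2) (v v' : ℤ × ℤ × ℤ)
    (hvv' : (v, v') ∈ ([(((1 : ℤ), (-1 : ℤ), (0 : ℤ)), ((0 : ℤ), (-1 : ℤ), (1 : ℤ))),
        ((1, -1, 0), (0, -1, -1)),
        ((1, 0, 1), (0, 1, 1)),
        ((1, 0, 1), (0, -1, 1)),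
        ((1, 0, -1), (0, 1, -1)),
        ((1, 0, -1), (0, -1, -1))] : List ((ℤ × ℤ × ℤ) × (ℤ × ℤ × ℤ))))
    (h : ∀ s ∈ ([((1 : ℤ), (1 : ℤ), (0 : ℤ)), (1, -1, 0), (-1, 1, 0), (-1, -1, 0), (1, 0, 1), (1, 0, -1),
        (-1, 0, 1), (-1, 0, -1), (0, 1, 1), (0, 1, -1), (0, -1, 1), (0, -1, -1)] : List (ℤ × ℤ × ℤ)), s ≠ v → s ≠ v' →
      a * (s.1 : ℝ) + b * (s.2.1 : ℝ) + c * (s.2.2 : ℝ) ≤ 1)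
    (h' : ∀ s ∈ ([((1 : ℤ), (1 : ℤ), (0 : ℤ)), (1, -1, 0), (-1, 1, 0), (-1, -1, 0), (1, 0, 1), (1, 0, -1),
        (-1, 0, 1), (-1, 0, -1), (0, 1, 1), (0, 1, -1), (0, -1, 1), (0, -1, -1)] : List (ℤ × ℤ × ℤ)), s ≠ v → s ≠ v' →
      a' * (s.1 : ℝ) + b' * (s.2.1 : ℝ) + c' * (s.2.2 : ℝ) ≤ 1)
    (hin : a * a' + b * b' + c * c' ≤ 1) :
    (a = v.1 ∧ b = v.2.1 ∧ c = v.2.2 ∧ a' = v'.1 ∧ b' = v'.2.1 ∧ c' = v'.2.2) ∨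
      (a = v'.1 ∧ b = v'.2.1 ∧ c = v'.2.2 ∧ a' = v.1 ∧ b' = v.2.1 ∧ c' = v.2.2) := by
  simp only [List.mem_cons, List.mem_nil_iff, or_false, Prod.mk.injEq] at hvv'
  rcases hvv' with ⟨rfl, rfl⟩ | ⟨rfl, rfl⟩ | ⟨rfl, rfl⟩ | ⟨rfl, rfl⟩ | ⟨rfl, rfl⟩ | ⟨rfl, rfl⟩
  · -- (v, v') = ((1, -1, 0), (0, -1, 1))
    simp only [List.forall_mem_cons, ne_eq, Prod.mk.injEq] at h h'
    norm_num at h h'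
    obtain ⟨g1, g2, g3, g4, g5, g6, g7, g8, g9, g10⟩ := h
    obtain ⟨k1, k2, k3, k4, k5, k6, k7, k8, k9, k10⟩ := h'
    have hsq : (-b) ^ 2 + (a) ^ 2 + (c) ^ 2 = 2 := by linear_combination hn
    have hsq' : (-b') ^ 2 + (a') ^ 2 + (c') ^ 2 = 2 := by linear_combination hn'
    have hin' : (-b) * (-b') + (a) * (a') + (c) * (c') ≤ 1 := by
      have e : (-b) * (-b') + (a) * (a') + (c) * (c') = a * a' + b * b' + c * c' := by ring
      rw [e]; exact hin
    rcases cubicShell_lens_base (-b) (a) (c) (-b') (a') (c') hsq hsq'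
      (by linarith) (by linarith) (by linarith) (by linarith) (by linarith)
      (by linarith) (by linarith) (by linarith) (by linarith) (by linarith)
      (by linarith) (by linarith) (by linarith) (by linarith) (by linarith)
      (by linarith) (by linarith) (by linarith) (by linarith) (by linarith) hin' with
      ⟨e1, e2, e3, e4, e5, e6⟩ | ⟨e1, e2, e3, e4, e5, e6⟩
    · left; refine ⟨?_, ?_, ?_, ?_, ?_, ?_⟩ <;> push_cast <;> linarith
    · right; refine ⟨?_, ?_, ?_, ?_, ?_, ?_⟩ <;> push_cast <;> linarith
  · -- (v, v') = ((1, -1, 0), (0, -1, -1))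
    simp only [List.forall_mem_cons, ne_eq, Prod.mk.injEq] at h h'
    norm_num at h h'
    obtain ⟨g1, g2, g3, g4, g5, g6, g7, g8, g9, g10⟩ := h
    obtain ⟨k1, k2, k3, k4, k5, k6, k7, k8, k9, k10⟩ := h'
    have hsq : (-b) ^ 2 + (a) ^ 2 + (-c) ^ 2 = 2 := by linear_combination hn
    have hsq' : (-b') ^ 2 + (a') ^ 2 + (-c') ^ 2 = 2 := by linear_combination hn'
    have hin' : (-b) * (-b') + (a) * (a') + (-c) * (-c') ≤ 1 := by
      have e : (-b) * (-b') + (a) * (a') + (-c) * (-c') = a * a' + b * b' + c * c' := by ring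
      rw [e]; exact hin
    rcases cubicShell_lens_base (-b) (a) (-c) (-b') (a') (-c') hsq hsq'
      (by linarith) (by linarith) (by linarith) (by linarith) (by linarith)
      (by linarith) (by linarith) (by linarith) (by linarith) (by linarith)
      (by linarith) (by linarith) (by linarith) (by linarith) (by linarith)
      (by linarith) (by linarith) (by linarith) (by linarith) (by linarith) hin' with
      ⟨e1, e2, e3, e4, e5, e6⟩ | ⟨e1, e2, e3, e4, e5, e6⟩
    · left; refine ⟨?_, ?_, ?_, ?_, ?_, ?_⟩ <;> push_cast <;> linarith
    · right; refine ⟨?_, ?_, ?_, ?_, ?_, ?_⟩ <;> push_cast <;> linarith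
  · -- (v, v') = ((1, 0, 1), (0, 1, 1))
    simp only [List.forall_mem_cons, ne_eq, Prod.mk.injEq] at h h'
    norm_num at h h'
    obtain ⟨g1, g2, g3, g4, g5, g6, g7, g8, g9, g10⟩ := h
    obtain ⟨k1, k2, k3, k4, k5, k6, k7, k8, k9, k10⟩ := h'
    have hsq : (c) ^ 2 + (a) ^ 2 + (b) ^ 2 = 2 := by linear_combination hn
    have hsq' : (c') ^ 2 + (a') ^ 2 + (b') ^ 2 = 2 := by linear_combination hn'
    have hin' : (c) * (c') + (a) * (a') + (b) * (b') ≤ 1 := by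
      have e : (c) * (c') + (a) * (a') + (b) * (b') = a * a' + b * b' + c * c' := by ring
      rw [e]; exact hin
    rcases cubicShell_lens_base (c) (a) (b) (c') (a') (b') hsq hsq'
      (by linarith) (by linarith) (by linarith) (by linarith) (by linarith)
      (by linarith) (by linarith) (by linarith) (by linarith) (by linarith)
      (by linarith) (by linarith) (by linarith) (by linarith) (by linarith)
      (by linarith) (by linarith) (by linarith) (by linarith) (by linarith) hin' with
      ⟨e1, e2, e3, e4, e5, e6⟩ | ⟨e1, e2, e3, e4, e5, e6⟩
    · left; refine ⟨?_, ?_, ?_, ?_, ?_, ?_⟩ <;> push_cast <;> linarith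
    · right; refine ⟨?_, ?_, ?_, ?_, ?_, ?_⟩ <;> push_cast <;> linarith
  · -- (v, v') = ((1, 0, 1), (0, -1, 1))
    simp only [List.forall_mem_cons, ne_eq, Prod.mk.injEq] at h h'
    norm_num at h h'
    obtain ⟨g1, g2, g3, g4, g5, g6, g7, g8, g9, g10⟩ := h
    obtain ⟨k1, k2, k3, k4, k5, k6, k7, k8, k9, k10⟩ := h'
    have hsq : (c) ^ 2 + (a) ^ 2 + (-b) ^ 2 = 2 := by linear_combination hn
    have hsq' : (c') ^ 2 + (a') ^ 2 + (-b') ^ 2 = 2 := by linear_combination hn'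
    have hin' : (c) * (c') + (a) * (a') + (-b) * (-b') ≤ 1 := by
      have e : (c) * (c') + (a) * (a') + (-b) * (-b') = a * a' + b * b' + c * c' := by ring
      rw [e]; exact hin
    rcases cubicShell_lens_base (c) (a) (-b) (c') (a') (-b') hsq hsq'
      (by linarith) (by linarith) (by linarith) (by linarith) (by linarith)
      (by linarith) (by linarith) (by linarith) (by linarith) (by linarith)
      (by linarith) (by linarith) (by linarith) (by linarith) (by linarith)
      (by linarith) (by linarith) (by linarith) (by linarith) (by linarith) hin' with
      ⟨e1, e2, e3, e4, e5, e6⟩ | ⟨e1, e2, e3, e4, e5, e6⟩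
    · left; refine ⟨?_, ?_, ?_, ?_, ?_, ?_⟩ <;> push_cast <;> linarith
    · right; refine ⟨?_, ?_, ?_, ?_, ?_, ?_⟩ <;> push_cast <;> linarith
  · -- (v, v') = ((1, 0, -1), (0, 1, -1))
    simp only [List.forall_mem_cons, ne_eq, Prod.mk.injEq] at h h'
    norm_num at h h'
    obtain ⟨g1, g2, g3, g4, g5, g6, g7, g8, g9, g10⟩ := h
    obtain ⟨k1, k2, k3, k4, k5, k6, k7, k8, k9, k10⟩ := h'
    have hsq : (-c) ^ 2 + (a) ^ 2 + (b) ^ 2 = 2 := by linear_combination hn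
    have hsq' : (-c') ^ 2 + (a') ^ 2 + (b') ^ 2 = 2 := by linear_combination hn'
    have hin' : (-c) * (-c') + (a) * (a') + (b) * (b') ≤ 1 := by
      have e : (-c) * (-c') + (a) * (a') + (b) * (b') = a * a' + b * b' + c * c' := by ring
      rw [e]; exact hin
    rcases cubicShell_lens_base (-c) (a) (b) (-c') (a') (b') hsq hsq'
      (by linarith) (by linarith) (by linarith) (by linarith) (by linarith)
      (by linarith) (by linarith) (by linarith) (by linarith) (by linarith)
      (by linarith) (by linarith) (by linarith) (by linarith) (by linarith)
      (by linarith) (by linarith) (by linarith) (by linarith) (by linarith) hin' with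
      ⟨e1, e2, e3, e4, e5, e6⟩ | ⟨e1, e2, e3, e4, e5, e6⟩
    · left; refine ⟨?_, ?_, ?_, ?_, ?_, ?_⟩ <;> push_cast <;> linarith
    · right; refine ⟨?_, ?_, ?_, ?_, ?_, ?_⟩ <;> push_cast <;> linarith
  · -- (v, v') = ((1, 0, -1), (0, -1, -1))
    simp only [List.forall_mem_cons, ne_eq, Prod.mk.injEq] at h h'
    norm_num at h h'
    obtain ⟨g1, g2, g3, g4, g5, g6, g7, g8, g9, g10⟩ := h
    obtain ⟨k1, k2, k3, k4, k5, k6, k7, k8, k9, k10⟩ := h'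
    have hsq : (-c) ^ 2 + (a) ^ 2 + (-b) ^ 2 = 2 := by linear_combination hn
    have hsq' : (-c') ^ 2 + (a') ^ 2 + (-b') ^ 2 = 2 := by linear_combination hn'
    have hin' : (-c) * (-c') + (a) * (a') + (-b) * (-b') ≤ 1 := by
      have e : (-c) * (-c') + (a) * (a') + (-b) * (-b') = a * a' + b * b' + c * c' := by ring
      rw [e]; exact hin
    rcases cubicShell_lens_base (-c) (a) (-b) (-c') (a') (-b') hsq hsq'
      (by linarith) (by linarith) (by linarith) (by linarith) (by linarith)
      (by linarith) (by linarith) (by linarith) (by linarith) (by linarith)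
      (by linarith) (by linarith) (by linarith) (by linarith) (by linarith)
      (by linarith) (by linarith) (by linarith) (by linarith) (by linarith) hin' with
      ⟨e1, e2, e3, e4, e5, e6⟩ | ⟨e1, e2, e3, e4, e5, e6⟩
    · left; refine ⟨?_, ?_, ?_, ?_, ?_, ?_⟩ <;> push_cast <;> linarith
    · right; refine ⟨?_, ?_, ?_, ?_, ?_, ?_⟩ <;> push_cast <;> linarith

end Summit.Ventures.Crystal3D.Theorems

end
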